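import Mathlib

/-!
# The test-charge distance identity and the Temple-type bracket from first principles (route K)

Kernel K29 of the solo-blind programme (session s61).  Finite-dimensional real inner-product
spaces; Mathlib only.

Setting (abstracting `ROUTE_KJ_s59` §1, Lemmas 1.1–1.3 = Lemma D′ₙ of s58).  `E` is a real
inner-product space with a finite orthonormal basis `b : ι → E` of eigenvectors of the kinetic
operator `K`, eigenvalues `ε : ι → ℝ`, `ε P₀ = 0` (the constant mode) and `ε P > s` for
`P ≠ P₀` (hypothesis (R): `s < 2ω_min` in the zero-momentum sector).  The hard-core eigenvalue
problem enters only through its consequence `K ψ - s ψ = -ρ` — the *charge* `ρ` and every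
*test charge* `φ` being orthogonal to `ψ` (they live on the collision set, where `ψ` vanishes).
In coordinates `a P = ⟪φ, b P⟫` the test-charge form is
`Q_s(a, c) = Σ_{P ≠ P₀} a P · c P / (ε P - s) - a P₀ · c P₀ / s`.

Results.
* `coord_relation_of_eigen` — the operator equation `K ψ - s ψ = -ρ` for symmetric `K` with
  eigenbasis `b` gives `⟪ρ, b P⟫ = -(ε P - s) ⟪ψ, b P⟫`;
* `chargeForm_eq_neg_inner` — `Q_s(g, ρ) = -⟪g, ψ⟫` for every `g` (Parseval);
* `testCharge_distance` — if `⟪φ, ψ⟫ = ⟪ρ, ψ⟫ = 0` and `φ`, `ρ` have the same `P₀`-coordinate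
  (same total charge) then `Q_s(φ, φ) = Σ_{P ≠ P₀} (⟪φ, b P⟫ - ⟪ρ, b P⟫)² / (ε P - s)`:
  the value of the form at a test charge IS its squared weighted distance to the true charge;
  hence `Q_s(φ, φ) ≥ 0` with equality iff `φ = ρ` (`testCharge_nonneg`, `testCharge_eq_zero_iff`);
* `theta_slope` — for `Θ(s) = Q_s(φ, φ)/(m A²)` with `⟪φ, b P₀⟫ = m A`:
  `(s_up - s) m / s_up² ≤ Θ(s_up) - Θ(s)` whenever `0 < s ≤ s_up < ε P` (`P ≠ P₀`);
* `temple_of_testCharge` — the Temple-type lower bound `s_up - Θ(s_up) s_up² / m ≤ s_n` for the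
  eigenvalue `s_n` of the charge relation, from ANY test charge and ANY upper bound
  `s_n ≤ s_up < min_{P ≠ P₀} ε P`.  This supplies, from the eigenvalue equation alone, the two
  hypotheses `0 ≤ Θ(s_n)` and the slope bound (on `(0, s_up]`, which is where it is used) of
  K28's `temple_lower_bound` (`SoloBlindDepletionBracket`).
-/

namespace Summit.AtomisticToContinuum.BoseEinsteinCondensation.Theorems

open Finset
open scoped InnerProductSpace

section Algebra

variable {ι : Type*} [Fintype ι] [DecidableEq ι]

/-- The test-charge form in coordinates:
`Q(a, c) = Σ_{P ≠ P₀} w P · a P · c P - w₀ · a P₀ · c P₀`. -/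
def chargeForm (P₀ : ι) (w : ι → ℝ) (w₀ : ℝ) (a c : ι → ℝ) : ℝ :=
  (∑ P ∈ univ.erase P₀, w P * (a P * c P)) - w₀ * (a P₀ * c P₀)

omit [Fintype ι] [DecidableEq ι] in
/-- Expansion of a weighted sum of squared differences. -/
theorem sum_weight_mul_sub_sq (S : Finset ι) (w a c : ι → ℝ) :
    ∑ P ∈ S, w P * (a P - c P) ^ 2
      = (∑ P ∈ S, w P * (a P * a P)) - 2 * (∑ P ∈ S, w P * (a P * c P))
        + ∑ P ∈ S, w P * (c P * c P) := by
  rw [Finset.mul_sum, ← Finset.sum_sub_distrib, ← Finset.sum_add_distrib]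
  exact Finset.sum_congr rfl (fun P _ => by ring)

/-- Algebraic distance identity: if `Q(a, c) = 0`, `Q(c, c) = 0` and `a P₀ = c P₀`, then
`Q(a, a) = Σ_{P ≠ P₀} w P (a P - c P)²`. -/
theorem chargeForm_self_eq_dist_of (P₀ : ι) (w : ι → ℝ) (w₀ : ℝ) (a c : ι → ℝ)
    (hac : chargeForm P₀ w w₀ a c = 0) (hcc : chargeForm P₀ w w₀ c c = 0) (h0 : a P₀ = c P₀) :
    chargeForm P₀ w w₀ a a = ∑ P ∈ univ.erase P₀, w P * (a P - c P) ^ 2 := by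
  simp only [chargeForm] at hac hcc ⊢
  rw [sum_weight_mul_sub_sq, h0]
  rw [h0] at hac
  linarith

/-- Nonnegativity of the form at a test charge with the right total charge. -/
theorem chargeForm_self_nonneg_of (P₀ : ι) (w : ι → ℝ) (w₀ : ℝ) (a c : ι → ℝ)
    (hw : ∀ P, P ≠ P₀ → 0 ≤ w P)
    (hac : chargeForm P₀ w w₀ a c = 0) (hcc : chargeForm P₀ w w₀ c c = 0) (h0 : a P₀ = c P₀) :
    0 ≤ chargeForm P₀ w w₀ a a := by
  rw [chargeForm_self_eq_dist_of P₀ w w₀ a c hac hcc h0]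
  exact Finset.sum_nonneg
    (fun P hP => mul_nonneg (hw P (Finset.ne_of_mem_erase hP)) (sq_nonneg _))

/-- Equality case: with strictly positive weights the form vanishes iff the test charge is
the true charge. -/
theorem chargeForm_self_eq_zero_iff_of (P₀ : ι) (w : ι → ℝ) (w₀ : ℝ) (a c : ι → ℝ)
    (hw : ∀ P, P ≠ P₀ → 0 < w P)
    (hac : chargeForm P₀ w w₀ a c = 0) (hcc : chargeForm P₀ w w₀ c c = 0) (h0 : a P₀ = c P₀) :
    chargeForm P₀ w w₀ a a = 0 ↔ a = c := by
  rw [chargeForm_self_eq_dist_of P₀ w w₀ a c hac hcc h0]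
  constructor
  · intro h
    have hterm : ∀ P ∈ univ.erase P₀, w P * (a P - c P) ^ 2 = 0 :=
      (Finset.sum_eq_zero_iff_of_nonneg (fun P hP =>
        mul_nonneg (hw P (Finset.ne_of_mem_erase hP)).le (sq_nonneg _))).mp h
    funext P
    by_cases hP : P = P₀
    · rw [hP]; exact h0
    · have h1 := hterm P (Finset.mem_erase.mpr ⟨hP, Finset.mem_univ P⟩)
      have hwP := hw P hP
      have h2 : (a P - c P) ^ 2 = 0 := by
        rcases mul_eq_zero.mp h1 with h3 | h3
        · exact absurd h3 hwP.ne'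
        · exact h3
      have h3 : a P - c P = 0 := (pow_eq_zero_iff two_ne_zero).mp h2
      linarith
  · intro h
    subst h
    exact Finset.sum_eq_zero (fun P _ => by simp)

/-- The normalised form `Θ(s) = Q_s(a, a)/(m A²)` with weights `w P = (ε P - s)⁻¹`, `w₀ = s⁻¹`,
as a function of the spectral parameter `s`. -/
noncomputable def thetaFn (P₀ : ι) (ε : ι → ℝ) (a : ι → ℝ) (m A : ℝ) (s : ℝ) : ℝ :=
  chargeForm P₀ (fun P => (ε P - s)⁻¹) s⁻¹ a a / (m * A ^ 2)

/-- Slope bound (Lemma 1.2): for `0 < s ≤ s_up < ε P` (`P ≠ P₀`) and `a P₀ = m A`,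
`(s_up - s) m / s_up² ≤ Θ(s_up) - Θ(s)`.  Each `P ≠ P₀` term is non-decreasing in `s`; the
`P₀` term contributes exactly `m (s_up - s)/(s s_up) ≥ m (s_up - s)/s_up²`. -/
theorem theta_slope (P₀ : ι) (ε : ι → ℝ) (a : ι → ℝ) (m A : ℝ) (hm : 0 < m) (hA : A ≠ 0)
    (ha0 : a P₀ = m * A) {s sup : ℝ} (hs : 0 < s) (hle : s ≤ sup)
    (hgap : ∀ P, P ≠ P₀ → sup < ε P) :
    (sup - s) * m / sup ^ 2 ≤ thetaFn P₀ ε a m A sup - thetaFn P₀ ε a m A s := by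
  have hsup : 0 < sup := lt_of_lt_of_le hs hle
  have hs' : s ≠ 0 := hs.ne'
  have hsup' : sup ≠ 0 := hsup.ne'
  have hA2 : 0 < A ^ 2 := by positivity
  have hmA2 : 0 < m * A ^ 2 := mul_pos hm hA2
  -- the `P ≠ P₀` part is non-decreasing in `s`
  have hsum : ∑ P ∈ univ.erase P₀, (ε P - s)⁻¹ * (a P * a P)
      ≤ ∑ P ∈ univ.erase P₀, (ε P - sup)⁻¹ * (a P * a P) := by
    apply Finset.sum_le_sum
    intro P hP
    have hP' := hgap P (Finset.ne_of_mem_erase hP)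
    have h1 : 0 < ε P - sup := sub_pos.mpr hP'
    have h2 : ε P - sup ≤ ε P - s := by linarith
    exact mul_le_mul_of_nonneg_right (inv_anti₀ h1 h2) (mul_self_nonneg _)
  -- Step 1: lower bound by the `P₀` terms
  have step1 : (s⁻¹ * (m * A * (m * A)) - sup⁻¹ * (m * A * (m * A))) / (m * A ^ 2)
      ≤ thetaFn P₀ ε a m A sup - thetaFn P₀ ε a m A s := by
    simp only [thetaFn, chargeForm]
    rw [← sub_div, ha0]
    apply div_le_div_of_nonneg_right _ hmA2.le
    linarith [hsum]
  -- Step 2: compute the `P₀` terms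
  have step2 : (s⁻¹ * (m * A * (m * A)) - sup⁻¹ * (m * A * (m * A))) / (m * A ^ 2)
      = (sup - s) * m / (s * sup) := by
    rw [div_eq_div_iff hmA2.ne' (mul_ne_zero hs' hsup')]
    field_simp
  -- Step 3: `s * sup ≤ sup²`
  have step3 : (sup - s) * m / sup ^ 2 ≤ (sup - s) * m / (s * sup) := by
    apply div_le_div_of_nonneg_left (mul_nonneg (sub_nonneg.mpr hle) hm.le) (by positivity)
    rw [sq]
    exact mul_le_mul_of_nonneg_right hle hsup.le
  linarith [step1, step2, step3]

end Algebra

section Spectral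

variable {E : Type*} [NormedAddCommGroup E] [InnerProductSpace ℝ E]
variable {ι : Type*} [Fintype ι] [DecidableEq ι]

omit [DecidableEq ι] in
/-- From the operator equation to the coordinate eigen-relation: if `K` is symmetric with
orthonormal eigenbasis `b`, `K (b P) = ε P • b P`, and `K ψ - s • ψ = -ρ`, then
`⟪ρ, b P⟫ = -(ε P - s) ⟪ψ, b P⟫` for every `P`. -/
theorem coord_relation_of_eigen (b : OrthonormalBasis ι ℝ E) (K : E →ₗ[ℝ] E)
    (hK : K.IsSymmetric) (ε : ι → ℝ) (hb : ∀ P, K (b P) = ε P • b P) (s : ℝ) (ψ ρ : E)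
    (heq : K ψ - s • ψ = -ρ) (P : ι) :
    ⟪ρ, b P⟫_ℝ = -((ε P - s) * ⟪ψ, b P⟫_ℝ) := by
  have h1 : ρ = -(K ψ - s • ψ) := by rw [heq, neg_neg]
  rw [h1, inner_neg_left, inner_sub_left, real_inner_smul_left, hK ψ (b P), hb P,
    real_inner_smul_right]
  ring

/-- Parseval form of the charge relation: `Q_s(g, ρ) = -⟪g, ψ⟫` for every `g`. -/
theorem chargeForm_eq_neg_inner (b : OrthonormalBasis ι ℝ E) (ε : ι → ℝ) (P₀ : ι) (s : ℝ)
    (ψ ρ g : E) (hs : s ≠ 0) (hε0 : ε P₀ = 0) (hεs : ∀ P, P ≠ P₀ → ε P ≠ s)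
    (hcoord : ∀ P, ⟪ρ, b P⟫_ℝ = -((ε P - s) * ⟪ψ, b P⟫_ℝ)) :
    chargeForm P₀ (fun P => (ε P - s)⁻¹) s⁻¹ (fun P => ⟪g, b P⟫_ℝ) (fun P => ⟪ρ, b P⟫_ℝ)
      = -⟪g, ψ⟫_ℝ := by
  have hterm : ∀ P ∈ univ.erase P₀,
      (ε P - s)⁻¹ * (⟪g, b P⟫_ℝ * ⟪ρ, b P⟫_ℝ) = -(⟪g, b P⟫_ℝ * ⟪ψ, b P⟫_ℝ) := by
    intro P hP
    have hne : ε P - s ≠ 0 := sub_ne_zero.mpr (hεs P (Finset.ne_of_mem_erase hP))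
    have key : (ε P - s)⁻¹ * (ε P - s) = 1 := inv_mul_cancel₀ hne
    rw [hcoord P]
    linear_combination (-(⟪g, b P⟫_ℝ * ⟪ψ, b P⟫_ℝ)) * key
  have h0term : s⁻¹ * (⟪g, b P₀⟫_ℝ * ⟪ρ, b P₀⟫_ℝ) = ⟪g, b P₀⟫_ℝ * ⟪ψ, b P₀⟫_ℝ := by
    have key : s⁻¹ * s = 1 := inv_mul_cancel₀ hs
    rw [hcoord P₀, hε0]
    linear_combination (⟪g, b P₀⟫_ℝ * ⟪ψ, b P₀⟫_ℝ) * key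
  have hpars : ∑ P, ⟪g, b P⟫_ℝ * ⟪ψ, b P⟫_ℝ = ⟪g, ψ⟫_ℝ := by
    rw [← b.sum_inner_mul_inner g ψ]
    exact Finset.sum_congr rfl (fun P _ => by rw [real_inner_comm (b P) ψ])
  rw [← Finset.sum_erase_add _ _ (Finset.mem_univ P₀)] at hpars
  simp only [chargeForm]
  rw [Finset.sum_congr rfl hterm, h0term, Finset.sum_neg_distrib]
  linarith

/-- **Distance identity** (Lemma 1.1 / D′ₙ).  Under the charge relation at parameter `s`
(`0 < s < ε P` for `P ≠ P₀`, `ε P₀ = 0`), for a charge `ρ` and a test charge `φ` both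
orthogonal to `ψ` and with the same `P₀`-coordinate, the test-charge form at `φ` equals the
weighted squared distance from `φ` to `ρ`. -/
theorem testCharge_distance (b : OrthonormalBasis ι ℝ E) (ε : ι → ℝ) (P₀ : ι) (s : ℝ)
    (ψ ρ φ : E) (hs : 0 < s) (hε0 : ε P₀ = 0) (hgap : ∀ P, P ≠ P₀ → s < ε P)
    (hcoord : ∀ P, ⟪ρ, b P⟫_ℝ = -((ε P - s) * ⟪ψ, b P⟫_ℝ))
    (hρψ : ⟪ρ, ψ⟫_ℝ = 0) (hφψ : ⟪φ, ψ⟫_ℝ = 0) (h0 : ⟪φ, b P₀⟫_ℝ = ⟪ρ, b P₀⟫_ℝ) :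
    chargeForm P₀ (fun P => (ε P - s)⁻¹) s⁻¹ (fun P => ⟪φ, b P⟫_ℝ) (fun P => ⟪φ, b P⟫_ℝ)
      = ∑ P ∈ univ.erase P₀, (ε P - s)⁻¹ * (⟪φ, b P⟫_ℝ - ⟪ρ, b P⟫_ℝ) ^ 2 := by
  have hs' : s ≠ 0 := hs.ne'
  have hεs : ∀ P, P ≠ P₀ → ε P ≠ s := fun P hP => (hgap P hP).ne'
  refine chargeForm_self_eq_dist_of P₀ _ _ _ (fun P => ⟪ρ, b P⟫_ℝ) ?_ ?_ h0
  · rw [chargeForm_eq_neg_inner b ε P₀ s ψ ρ φ hs' hε0 hεs hcoord, hφψ, neg_zero]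
  · rw [chargeForm_eq_neg_inner b ε P₀ s ψ ρ ρ hs' hε0 hεs hcoord, hρψ, neg_zero]

/-- Nonnegativity of the test-charge form (every test charge bounds the energy from below). -/
theorem testCharge_nonneg (b : OrthonormalBasis ι ℝ E) (ε : ι → ℝ) (P₀ : ι) (s : ℝ)
    (ψ ρ φ : E) (hs : 0 < s) (hε0 : ε P₀ = 0) (hgap : ∀ P, P ≠ P₀ → s < ε P)
    (hcoord : ∀ P, ⟪ρ, b P⟫_ℝ = -((ε P - s) * ⟪ψ, b P⟫_ℝ))
    (hρψ : ⟪ρ, ψ⟫_ℝ = 0) (hφψ : ⟪φ, ψ⟫_ℝ = 0) (h0 : ⟪φ, b P₀⟫_ℝ = ⟪ρ, b P₀⟫_ℝ) :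
    0 ≤ chargeForm P₀ (fun P => (ε P - s)⁻¹) s⁻¹ (fun P => ⟪φ, b P⟫_ℝ) (fun P => ⟪φ, b P⟫_ℝ) := by
  rw [testCharge_distance b ε P₀ s ψ ρ φ hs hε0 hgap hcoord hρψ hφψ h0]
  exact Finset.sum_nonneg (fun P hP =>
    mul_nonneg (inv_nonneg.mpr (sub_nonneg.mpr (hgap P (Finset.ne_of_mem_erase hP)).le))
      (sq_nonneg _))

/-- Equality case: the form vanishes at a test charge iff the test charge is the true charge. -/
theorem testCharge_eq_zero_iff (b : OrthonormalBasis ι ℝ E) (ε : ι → ℝ) (P₀ : ι) (s : ℝ)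
    (ψ ρ φ : E) (hs : 0 < s) (hε0 : ε P₀ = 0) (hgap : ∀ P, P ≠ P₀ → s < ε P)
    (hcoord : ∀ P, ⟪ρ, b P⟫_ℝ = -((ε P - s) * ⟪ψ, b P⟫_ℝ))
    (hρψ : ⟪ρ, ψ⟫_ℝ = 0) (hφψ : ⟪φ, ψ⟫_ℝ = 0) (h0 : ⟪φ, b P₀⟫_ℝ = ⟪ρ, b P₀⟫_ℝ) :
    chargeForm P₀ (fun P => (ε P - s)⁻¹) s⁻¹ (fun P => ⟪φ, b P⟫_ℝ) (fun P => ⟪φ, b P⟫_ℝ) = 0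
      ↔ φ = ρ := by
  have hs' : s ≠ 0 := hs.ne'
  have hεs : ∀ P, P ≠ P₀ → ε P ≠ s := fun P hP => (hgap P hP).ne'
  have hw : ∀ P, P ≠ P₀ → 0 < (fun P => (ε P - s)⁻¹) P :=
    fun P hP => inv_pos.mpr (sub_pos.mpr (hgap P hP))
  have hac : chargeForm P₀ (fun P => (ε P - s)⁻¹) s⁻¹ (fun P => ⟪φ, b P⟫_ℝ)
      (fun P => ⟪ρ, b P⟫_ℝ) = 0 := by
    rw [chargeForm_eq_neg_inner b ε P₀ s ψ ρ φ hs' hε0 hεs hcoord, hφψ, neg_zero]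
  have hcc : chargeForm P₀ (fun P => (ε P - s)⁻¹) s⁻¹ (fun P => ⟪ρ, b P⟫_ℝ)
      (fun P => ⟪ρ, b P⟫_ℝ) = 0 := by
    rw [chargeForm_eq_neg_inner b ε P₀ s ψ ρ ρ hs' hε0 hεs hcoord, hρψ, neg_zero]
  rw [chargeForm_self_eq_zero_iff_of P₀ _ _ (fun P => ⟪φ, b P⟫_ℝ) (fun P => ⟪ρ, b P⟫_ℝ)
    hw hac hcc h0]
  constructor
  · intro h
    have hco : ∀ P, ⟪b P, φ⟫_ℝ = ⟪b P, ρ⟫_ℝ := by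
      intro P
      have hP : ⟪φ, b P⟫_ℝ = ⟪ρ, b P⟫_ℝ := congr_fun h P
      rw [real_inner_comm (b P) φ, real_inner_comm (b P) ρ] at hP
      exact hP
    calc φ = ∑ i, ⟪b i, φ⟫_ℝ • b i := (b.sum_repr' φ).symm
      _ = ∑ i, ⟪b i, ρ⟫_ℝ • b i := Finset.sum_congr rfl (fun P _ => by rw [hco P])
      _ = ρ := b.sum_repr' ρ
  · intro h
    subst h
    rfl

/-- **Temple-type lower bound from a test charge** (Lemma 1.3).  If `s_n` carries the charge
relation (`0 < s_n`), `φ` is a test charge orthogonal to `ψ` with the total charge of `ρ`,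
`⟪φ, b P₀⟫ = m A` with `m > 0`, `A ≠ 0`, and `s_n ≤ s_up < ε P` for all `P ≠ P₀`, then
`s_up - Θ_φ(s_up) s_up² / m ≤ s_n`. -/
theorem temple_of_testCharge (b : OrthonormalBasis ι ℝ E) (ε : ι → ℝ) (P₀ : ι)
    (ψ ρ φ : E) (m A sn sup : ℝ) (hm : 0 < m) (hA : A ≠ 0)
    (hsn : 0 < sn) (hle : sn ≤ sup) (hε0 : ε P₀ = 0) (hgap : ∀ P, P ≠ P₀ → sup < ε P)
    (hcoord : ∀ P, ⟪ρ, b P⟫_ℝ = -((ε P - sn) * ⟪ψ, b P⟫_ℝ))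
    (hρψ : ⟪ρ, ψ⟫_ℝ = 0) (hφψ : ⟪φ, ψ⟫_ℝ = 0) (h0 : ⟪φ, b P₀⟫_ℝ = ⟪ρ, b P₀⟫_ℝ)
    (hcharge : ⟪φ, b P₀⟫_ℝ = m * A) :
    sup - thetaFn P₀ ε (fun P => ⟪φ, b P⟫_ℝ) m A sup * sup ^ 2 / m ≤ sn := by
  set Θ := thetaFn P₀ ε (fun P => ⟪φ, b P⟫_ℝ) m A with hΘ
  have hsup : 0 < sup := lt_of_lt_of_le hsn hle
  have hmA2 : 0 < m * A ^ 2 := mul_pos hm (by positivity)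
  have hgap' : ∀ P, P ≠ P₀ → sn < ε P := fun P hP => lt_of_le_of_lt hle (hgap P hP)
  -- `0 ≤ Θ(s_n)` : the distance identity
  have h0Θ : 0 ≤ Θ sn := by
    rw [hΘ]
    simp only [thetaFn]
    exact div_nonneg (testCharge_nonneg b ε P₀ sn ψ ρ φ hsn hε0 hgap' hcoord hρψ hφψ h0)
      hmA2.le
  -- slope bound at `s = s_n`
  have h1 : (sup - sn) * m / sup ^ 2 ≤ Θ sup - Θ sn :=
    theta_slope P₀ ε (fun P => ⟪φ, b P⟫_ℝ) m A hm hA hcharge hsn hle hgap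
  have hsup2 : 0 < sup ^ 2 := by positivity
  have h2 : (sup - sn) * m / sup ^ 2 ≤ Θ sup := by linarith
  have h3 : (sup - sn) * m ≤ Θ sup * sup ^ 2 := by
    have := (div_le_iff₀ hsup2).mp h2
    linarith
  have h4 : sup - sn ≤ Θ sup * sup ^ 2 / m := by
    rw [le_div_iff₀ hm]; linarith
  linarith

end Spectral

end Summit.AtomisticToContinuum.BoseEinsteinCondensation.Theorems
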